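import Mathlib

/-!
# `SnSubsetDichotomy.ThresholdSubsetTriples`, line `interleaved-subsignature-ascent` — chain-class vocabulary

Objects of the line `interleaved-subsignature-ascent` of crux `stmt-MatrixMultiplication-10882`
(skeleton `Cruxes/ThresholdSubsetTriples/Lines/interleaved_subsignature_ascent.lean`), landed once so that
the line's stub files (`stub_card`, `stub_push`) and its composition import ONE copy:

* `starPiece E t = {swap e t : e ∈ E}` — the star piece at token `t` with direction set `E`
  (`e = t` is the identity letter), `card_starPiece`, and the push rule `mul_swap_of_apply_eq`
  (`q · swap(e,t) = swap(q e, t) · q` when `q t = t`);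
* `LevelCondition t E₁ E₂ E₃ L₁ L₂ L₃` — the token-eliminated form of the triple product property of
  `(starPiece E₁ t * L₁, starPiece E₂ t * L₂, starPiece E₃ t * L₃)` (the equivalence is the line's
  `stub_push`);
* `IsDirectionSystem D` (`d ≤ k` for `d ∈ D k`), the iterated pointwise products `subsigBelow D m`
  (levels `< m`, top level leftmost) and the sub-signature (chain) class `subsig D = subsigBelow D n`,
  with `subsigBelow_apply_of_le` (words on levels `< m` fix every point `≥ m`),
  `subsigBelow_apply_last` and the definitional top peeling `subsig_succ`.

Everything here is copied from the planner's kernel-checked skeleton (definitions verbatim, proofs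
verbatim); no statement of the route is touched.  Sources: Fisher–Yates / Sims stabiliser-chain normal
form (folklore); Cohn–Umans 2003 Def. 2.1 for the TPP (tree `TripleProductProperty`, not imported here —
this file is pure permutation-group vocabulary).
-/

-- `Summit.<Summit>.<Problem>` is the tree's mandated summit-side namespace; for this
-- single-conjunct summit the two coincide, so the file silences `dupNamespace`.
set_option linter.dupNamespace false
set_option autoImplicit false

namespace Summit.MatrixMultiplication.MatrixMultiplication.Theorems.ThresholdSubsetTriples

open scoped Pointwise

/-! ## Star pieces and the token-eliminated level condition -/

section Star

variable {α : Type*} [DecidableEq α] [Fintype α]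

/-- The STAR PIECE at token `t` with direction set `E`: `{swap e t : e ∈ E}` (`e = t` is the identity
letter `swap t t = 1`). -/
def starPiece (E : Finset α) (t : α) : Finset (Equiv.Perm α) :=
  E.image fun e => Equiv.swap e t

omit [Fintype α] in
/-- `e ↦ swap e t` is injective (evaluate at `t`). -/
theorem swap_left_injective (t : α) : Function.Injective fun e : α => Equiv.swap e t := by
  intro e e' h
  have h' := congrArg (fun σ : Equiv.Perm α => σ t) h
  simpa [Equiv.swap_apply_right] using h'

/-- A star piece has exactly `|E|` letters. -/
theorem card_starPiece (E : Finset α) (t : α) : (starPiece E t).card = E.card :=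
  Finset.card_image_of_injective _ (swap_left_injective t)

/-- Membership in a star piece: the letters are exactly the `swap e t`, `e ∈ E`. -/
theorem mem_starPiece {E : Finset α} {t : α} {σ : Equiv.Perm α} :
    σ ∈ starPiece E t ↔ ∃ e ∈ E, Equiv.swap e t = σ := by
  unfold starPiece
  exact Finset.mem_image

omit [Fintype α] in
/-- Pushing a token-fixing permutation through a star letter: `q · swap(e,t) = swap(q e, t) · q` if
`q t = t`. -/
theorem mul_swap_of_apply_eq (q : Equiv.Perm α) {t : α} (hq : q t = t) (e : α) :
    q * Equiv.swap e t = Equiv.swap (q e) t * q := by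
  rw [Equiv.mul_swap_eq_swap_mul, hq]

/-- **The token-eliminated level condition.**  With `q₁ = a a'⁻¹`, `q₂ = b b'⁻¹`, `q₃ = c c'⁻¹` the TPP
relation `swap(e₁,t) q₁ swap(e₁',t) · swap(e₂,t) q₂ swap(e₂',t) · swap(e₃,t) q₃ swap(e₃',t) = 1` of the
triple `(starPiece E₁ t * L₁, starPiece E₂ t * L₂, starPiece E₃ t * L₃)` becomes, after pushing the
`qᵢ` to the right (`mul_swap_of_apply_eq`, the `Lᵢ` fixing `t`), a six-letter STAR WORD at `t` times
`q₁q₂q₃`; `LevelCondition` asks that this pushed relation have only the trivial solutions.  It is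
equivalent to that TPP (the line's `stub_push`). -/
def LevelCondition (t : α) (E₁ E₂ E₃ : Finset α) (L₁ L₂ L₃ : Finset (Equiv.Perm α)) : Prop :=
  ∀ e₁ ∈ E₁, ∀ e₁' ∈ E₁, ∀ e₂ ∈ E₂, ∀ e₂' ∈ E₂, ∀ e₃ ∈ E₃, ∀ e₃' ∈ E₃,
  ∀ a ∈ L₁, ∀ a' ∈ L₁, ∀ b ∈ L₂, ∀ b' ∈ L₂, ∀ c ∈ L₃, ∀ c' ∈ L₃,
    Equiv.swap e₁ t * Equiv.swap ((a * a'⁻¹) e₁') t * Equiv.swap ((a * a'⁻¹) e₂) t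
        * Equiv.swap ((a * a'⁻¹ * (b * b'⁻¹)) e₂') t * Equiv.swap ((a * a'⁻¹ * (b * b'⁻¹)) e₃) t
        * Equiv.swap ((a * a'⁻¹ * (b * b'⁻¹) * (c * c'⁻¹)) e₃') t
        * (a * a'⁻¹ * (b * b'⁻¹) * (c * c'⁻¹)) = 1 →
      (e₁ = e₁' ∧ a = a') ∧ (e₂ = e₂' ∧ b = b') ∧ (e₃ = e₃' ∧ c = c')

end Star

/-! ## Direction systems and sub-signature (chain) classes -/

section Chain

variable {n : ℕ}

/-- A direction system on `n` points: level `k` uses directions `d ≤ k` (the direction `d = k` encodes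
the identity letter `swap k k = 1`). -/
def IsDirectionSystem (D : Fin n → Finset (Fin n)) : Prop :=
  ∀ k, ∀ d ∈ D k, d ≤ k

/-- Levels `< m` of the chain class of `D`: the pointwise product `P_{m−1} · P_{m−2} ⋯ P_0` of the star
pieces `P_k = starPiece (D k) k`, top level LEFTMOST (so `subsigBelow D (k+1) = P_k * subsigBelow D k`
by `rfl`); levels `≥ n` contribute the trivial piece. -/
def subsigBelow (D : Fin n → Finset (Fin n)) : ℕ → Finset (Equiv.Perm (Fin n))
  | 0 => {1}
  | m + 1 => (if h : m < n then starPiece (D ⟨m, h⟩) ⟨m, h⟩ else {1}) * subsigBelow D m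

/-- The SUB-SIGNATURE (chain) class `S_D` of a direction system: all words
`swap(d_{n−1}, n−1) ⋯ swap(d_1, 1) swap(d_0, 0)` with `d_k ∈ D k`, organised as an iterated pointwise
product so that the top-level peeling `subsig_succ` is definitional.  Young subgroups with a
block-compatible labelling are the transitive case `D k = {j ≤ k : j ∼ k}`. -/
def subsig (D : Fin n → Finset (Fin n)) : Finset (Equiv.Perm (Fin n)) :=
  subsigBelow D n

/-- Unfolding lemmas for `subsigBelow` (by `rfl`). -/
theorem subsigBelow_zero (D : Fin n → Finset (Fin n)) : subsigBelow D 0 = {1} := rfl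

/-- Unfolding lemma for `subsigBelow` at a successor level (by `rfl`). -/
theorem subsigBelow_succ (D : Fin n → Finset (Fin n)) (m : ℕ) :
    subsigBelow D (m + 1) =
      (if h : m < n then starPiece (D ⟨m, h⟩) ⟨m, h⟩ else {1}) * subsigBelow D m := rfl

/-- Inside the range, the successor level multiplies by the star piece of that level. -/
theorem subsigBelow_succ_of_lt (D : Fin n → Finset (Fin n)) {m : ℕ} (h : m < n) :
    subsigBelow D (m + 1) = starPiece (D ⟨m, h⟩) ⟨m, h⟩ * subsigBelow D m := by
  rw [subsigBelow_succ, dif_pos h]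

/-- `subsig D` unfolds to `subsigBelow D n` (by `rfl`). -/
theorem subsig_eq (D : Fin n → Finset (Fin n)) : subsig D = subsigBelow D n := rfl

/-- Words using only levels `< m` fix every point `p ≥ m` (directions at level `k` are `≤ k`). -/
theorem subsigBelow_apply_of_le (D : Fin n → Finset (Fin n)) (hD : IsDirectionSystem D) :
    ∀ (m : ℕ) (τ : Equiv.Perm (Fin n)), τ ∈ subsigBelow D m → ∀ p : Fin n, m ≤ (p : ℕ) → τ p = p := by
  intro m
  induction m with
  | zero =>
    intro τ hτ p _
    simp only [subsigBelow, Finset.mem_singleton] at hτ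
    subst hτ
    rfl
  | succ m ih =>
    intro τ hτ p hp
    simp only [subsigBelow] at hτ
    obtain ⟨y, hy, z, hz, rfl⟩ := Finset.mem_mul.1 hτ
    have hz' : z p = p := ih z hz p (by omega)
    rw [Equiv.Perm.mul_apply, hz']
    by_cases h : m < n
    · rw [dif_pos h, starPiece] at hy
      obtain ⟨e, he, rfl⟩ := Finset.mem_image.1 hy
      have he' : e ≤ (⟨m, h⟩ : Fin n) := hD _ e he
      have h1 : (e : ℕ) ≤ m := he'
      apply Equiv.swap_apply_of_ne_of_ne
      · intro hpe
        have hh : (p : ℕ) = (e : ℕ) := congrArg Fin.val hpe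
        omega
      · intro hpm
        have hh : (p : ℕ) = m := congrArg Fin.val hpm
        omega
    · rw [dif_neg h, Finset.mem_singleton] at hy
      subst hy
      rfl

/-- In particular the lower chain class of an `(n+1)`-point system lies in the stabiliser of the top
point. -/
theorem subsigBelow_apply_last (D : Fin (n + 1) → Finset (Fin (n + 1))) (hD : IsDirectionSystem D) :
    ∀ τ ∈ subsigBelow D n, τ (Fin.last n) = Fin.last n :=
  fun τ hτ => subsigBelow_apply_of_le D hD n τ hτ (Fin.last n) (by simp)

/-- Top-level peeling (definitional): `S_D = P_{last} · S_{D,<n}` on `n+1` points. -/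
theorem subsig_succ (D : Fin (n + 1) → Finset (Fin (n + 1))) :
    subsig D = starPiece (D (Fin.last n)) (Fin.last n) * subsigBelow D n := by
  show subsigBelow D (n + 1) = _
  rw [subsigBelow, dif_pos n.lt_succ_self]
  rfl

end Chain

end Summit.MatrixMultiplication.MatrixMultiplication.Theorems.ThresholdSubsetTriples
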